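import Summits.CriticalPhenomena.PercolationContinuityZ3.Theorems.PercNearOneGluingNoHeavyLowerTailAPLSeriesParallel
import Summits.CriticalPhenomena.PercolationContinuityZ3.Theorems.PercNearOneGluingNoHeavyLowerTailAPLLadderApex
import HarnessLib

/-!
# `NoHeavyLowerTail` (stmt-CriticalPhenomena-4575) — COROLLARIES OF THE SERIES–PARALLEL THEOREM: the three-point inequality
# `P(g ↔ u, g ↔ v)² ≤ (28/27)·P(g ↔ u)·P(g ↔ v)·P(u ↔ v)` inside series–parallel graphs, and the "core + hubs anywhere" form

Support file (prover prim-ineq-gen-8 gen 61; `--supports stmt-CriticalPhenomena-4575`; memo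
run/shared/lean/prim/prim-ineq-gen-8/FINDING-gen61-SPTHEOREM.md §1).  No definitions, no named facts, no sorries.

* **`sp_threePoint_le`** — the weak-apex shadow of `sp_E_le` (`…APLSeriesParallel`): if the apex `o` of a `GZSP.IsSPNet o E u v` meets exactly one
  edge `s(o, g)`, then for the core `R = E ∖ s(o,g)` and all weights in `[0,1]`:
  `P_R(g ↔ u, g ↔ v)² ≤ (28/27)·P_R(g ↔ u)·P_R(g ↔ v)·P_R(u ↔ v)`.  Proof: by `pendant_apex_numbers` (`…APLLadderApex`) the inequality of `sp_E_le`
  for apex weight `ε ∈ (0,1]` reads `(τ − εpπ)² ≤ (28/27)·pπ·(s − ετ)` in the core numbers; let `ε → 0` (explicit `ε = min(1, D/4)`).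
* `GZSP.IsSPNet.insert_hub`, `GZSP.IsSPNet.union_hubs` — syntax lemmas: a hub edge may be attached at ANY vertex of a network of the class
  afterwards (induction over the derivation: attach it where the vertex is a terminal, carry it through the compositions); hence the class is exactly
  "two-terminal series–parallel core + hub joined to any subset of its vertices".
* **`sp_E_le_hubs`** — the series–parallel theorem in core form: `GZSP.IsSPNet o R u v` for a core `R` avoiding `o`, apex joined to any finite set `A`
  of vertices of `R`: `E ≤ 28/27` on `R ∪ {s(g,o) : g ∈ A}`.
* **`sp_threePoint_le'`** — the three-point inequality in core form: `R` two-terminal series–parallel (`GZSP.IsSPNet o R u v`, `o` off `R`), `g` any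
  vertex of `R`: `P_R(g ↔ u, g ↔ v)² ≤ (28/27)·P_R(g ↔ u)·P_R(g ↔ v)·P_R(u ↔ v)`.
The constant is sharp (`sp_E_le_sharp`, `…APLLadderSharpness`: balanced ladders); for `g` on a string of beads between `u` and `v` the ratio is
`≤ 1` (`beadChain_E_le_one`), and on general finite graphs it reaches `1.1158` (memo gen 56). [this work]
-/

namespace Summit.CriticalPhenomena.PercolationContinuityZ3.Theorems

namespace APL

open Literature.Probability.Percolation Literature.Probability.Percolation.Gladkov Literature.Probability.Percolation.DecisionTree
open scoped Classical

variable {V : Type*} [Fintype V]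

/-! ### Corollary: the three-point inequality inside series–parallel graphs (the weak-apex shadow of `sp_E_le`) -/

/-- **THREE-POINT INEQUALITY IN SERIES–PARALLEL GRAPHS.**  Let the apex `o` of a two-terminal series–parallel apex network `E` (`GZSP.IsSPNet o E u v`)
meet exactly one edge, `s(o, g)` (`o ≠ g`), and let `R = E ∖ {s(o,g)}` be the core — an arbitrary two-terminal series–parallel graph with terminals
`u, v` and an arbitrary vertex `g`.  Then for all weights in `[0,1]`:
`P_R(g ↔ u, g ↔ v)² ≤ (28/27) · P_R(g ↔ u) · P_R(g ↔ v) · P_R(u ↔ v)`.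
(Proof: `sp_E_le` for the apex weight `ε ∈ (0,1]` reads, by `pendant_apex_numbers`, `(τ − ε pπ)² ≤ (28/27)·pπ·(s − ετ)`; let `ε → 0`.)  The constant is
sharp (balanced ladders, `sp_E_le_sharp`); on general finite graphs the same ratio reaches `1.1158` (memo gen 56), and for `g` on a `u–v` path of
beads it is `≤ 1` (`beadChain_E_le_one`). [this work] -/
theorem sp_threePoint_le (p : Sym2 V → ℝ) (hp0 : ∀ e, 0 ≤ p e) (hp1 : ∀ e, p e ≤ 1) {o g u v : V} {E : Finset (Sym2 V)}
    (h : GZSP.IsSPNet o E u v) (hog : o ≠ g) (he : s(o, g) ∈ E) (hD : ∀ f ∈ E, o ∈ f → f = s(o, g)) :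
    (PrW (E.erase s(o, g)) p {K : Finset (Sym2 V) | u ∈ cl K g ∧ v ∈ cl K g}) ^ 2
      ≤ 28 / 27 * PrW (E.erase s(o, g)) p {K : Finset (Sym2 V) | u ∈ cl K g} * PrW (E.erase s(o, g)) p {K : Finset (Sym2 V) | v ∈ cl K g}
        * PrW (E.erase s(o, g)) p {K : Finset (Sym2 V) | v ∈ cl K u} := by
  obtain ⟨-, huo, hvo⟩ := h.terminals_ne
  set R := E.erase s(o, g) with hRdef
  have hER : E = insert s(o, g) R := (Finset.insert_erase he).symm
  have hR : ∀ f ∈ R, o ∉ f := fun f hf hof => by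
    rw [hRdef, Finset.mem_erase] at hf
    exact hf.1 (hD f hf.2 hof)
  have hnot : s(o, g) ∉ R := fun hm => hR _ hm (Sym2.mem_mk_left _ _)
  set a := PrW R p {K : Finset (Sym2 V) | u ∈ cl K g} with ha
  set b := PrW R p {K : Finset (Sym2 V) | v ∈ cl K g} with hb
  set t := PrW R p {K : Finset (Sym2 V) | u ∈ cl K g ∧ v ∈ cl K g} with ht
  set m := PrW R p {K : Finset (Sym2 V) | u ∉ cl K g ∧ v ∈ cl K u} with hm
  have hs : PrW R p {K : Finset (Sym2 V) | v ∈ cl K u} = m + t := by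
    rw [pendant_split_bc' p R g u v, ← m_event_eq_cell p R g u v]
  have ha0 : 0 ≤ a := PrW_nonneg R hp0 hp1 _
  have hb0 : 0 ≤ b := PrW_nonneg R hp0 hp1 _
  have ht0 : 0 ≤ t := PrW_nonneg R hp0 hp1 _
  have ha1 : a ≤ 1 := PrW_cl_le_one R hp0 hp1 _
  have hb1 : b ≤ 1 := PrW_cl_le_one R hp0 hp1 _
  have ht1 : t ≤ 1 := PrW_cl_le_one R hp0 hp1 _
  -- the inequality for every apex weight ε ∈ (0, 1]
  have key : ∀ ε : ℝ, 0 < ε → ε ≤ 1 → (t - ε * (a * b)) ^ 2 ≤ 28 / 27 * (a * b) * (m + t - ε * t) := by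
    intro ε hε0 hε1
    set q : Sym2 V → ℝ := Function.update p s(o, g) ε with hq
    have hq0 : ∀ e, 0 ≤ q e := fun e => by
      rw [hq]; rcases eq_or_ne e s(o, g) with rfl | hne
      · rw [Function.update_self]; exact hε0.le
      · rw [Function.update_of_ne hne]; exact hp0 e
    have hq1 : ∀ e, q e ≤ 1 := fun e => by
      rw [hq]; rcases eq_or_ne e s(o, g) with rfl | hne
      · rw [Function.update_self]; exact hε1
      · rw [Function.update_of_ne hne]; exact hp1 e
    have hqε : q s(o, g) = ε := by rw [hq, Function.update_self]
    have hqR : ∀ X : Set (Finset (Sym2 V)), PrW R q X = PrW R p X := fun X =>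
      PrW_congr_weights R (fun i hi => by
        have hne : i ≠ s(o, g) := by rintro rfl; exact hnot hi
        rw [hq, Function.update_of_ne hne]) X
    have hsp := sp_E_le q hq0 hq1 h
    obtain ⟨e1, e2, e3, e4⟩ := pendant_apex_numbers q R o g u v hog huo hvo hR
    rw [hER, e1, e2, e3, e4, hqR, hqR, hqR, hqR, hqε] at hsp
    have hε2 : 0 < ε ^ 2 := by positivity
    nlinarith [hsp]
  -- let ε → 0
  rw [hs]
  by_contra hcon
  have hlt := not_le.mp hcon
  set D := t ^ 2 - 28 / 27 * a * b * (m + t) with hDdef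
  have hD : 0 < D := by rw [hDdef]; linarith
  set ε₀ : ℝ := min 1 (D / 4) with hε₀
  have hε₀0 : 0 < ε₀ := lt_min one_pos (by positivity)
  have hε₀1 : ε₀ ≤ 1 := min_le_left _ _
  have hε₀D : ε₀ ≤ D / 4 := min_le_right _ _
  have hk := key ε₀ hε₀0 hε₀1
  have hprod : 0 ≤ a * b * t := mul_nonneg (mul_nonneg ha0 hb0) ht0
  have hprod1 : a * b * t ≤ 1 := by
    calc a * b * t ≤ 1 * 1 * 1 := by gcongr
      _ = 1 := by ring
  have hq1 : ε₀ * (a * b * t) ≤ ε₀ := by nlinarith [mul_le_mul_of_nonneg_left hprod1 hε₀0.le]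
  have hq2 : 0 ≤ 28 / 27 * (a * b) * (ε₀ * t) := by
    have := mul_nonneg hε₀0.le hprod; positivity
  have hDle : D ≤ 2 * ε₀ := by nlinarith [hk, sq_nonneg (ε₀ * (a * b)), mul_nonneg hε₀0.le hprod]
  linarith

/-! ### Hub edges may be attached afterwards: the class is "series–parallel core + apex joined to any set of its vertices" -/

omit [Fintype V] in
/-- **Attaching a hub edge at an arbitrary vertex.**  If `E` is a two-terminal series–parallel hub network (`GZSP.IsSPNet c E a b`) and `g ≠ c` is any
vertex of `E` whose hub edge `s(g, c)` is not yet present, then `insert s(g, c) E` is again in the class (induction over the syntax: the hub edge is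
attached at the stage where `g` is a terminal and carried through the later series/parallel compositions).  Hence `GZSP.IsSPNet` = "a two-terminal
series–parallel core with the hub joined to ANY subset of its vertices". [folklore] -/
theorem _root_.Summit.CriticalPhenomena.PercolationContinuityZ3.Theorems.GZSP.IsSPNet.insert_hub {c : V} {E : Finset (Sym2 V)} {a b : V}
    (h : GZSP.IsSPNet c E a b) {g : V} (hg : ∃ f ∈ E, g ∈ f) (hgc : g ≠ c) (hnew : s(g, c) ∉ E) :
    GZSP.IsSPNet c (insert s(g, c) E) a b := by
  induction h with
  | @edge a b hab hac hbc =>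
    obtain ⟨f, hf, hgf⟩ := hg
    rw [Finset.mem_singleton] at hf
    subst hf
    rcases Sym2.mem_iff.1 hgf with rfl | rfl
    · exact GZSP.IsSPNet.hubLeft (GZSP.IsSPNet.edge hab hac hbc) hnew
    · exact GZSP.IsSPNet.hubRight (GZSP.IsSPNet.edge hab hac hbc) hnew
  | @hubLeft E a b h he ih =>
    obtain ⟨f, hf, hgf⟩ := hg
    rw [Finset.mem_insert] at hf
    have hga : g ≠ a := fun hga => hnew (by rw [hga]; exact Finset.mem_insert_self _ _)
    have hgE : ∃ f ∈ E, g ∈ f := by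
      rcases hf with rfl | hf
      · rcases Sym2.mem_iff.1 hgf with h1 | h1
        · exact absurd h1 hga
        · exact absurd h1 hgc
      · exact ⟨f, hf, hgf⟩
    have h' := ih hgE (fun hm => hnew (Finset.mem_insert_of_mem hm))
    rw [Finset.insert_comm]
    refine GZSP.IsSPNet.hubLeft h' ?_
    rw [Finset.mem_insert, not_or]
    refine ⟨fun heq => hga ?_, he⟩
    have := (Sym2.eq_iff.1 heq)
    rcases this with ⟨h1, -⟩ | ⟨h1, h2⟩
    · exact h1.symm
    · exact absurd h2 hgc.symm
  | @hubRight E a b h he ih =>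
    obtain ⟨f, hf, hgf⟩ := hg
    rw [Finset.mem_insert] at hf
    have hgb : g ≠ b := fun hgb => hnew (by rw [hgb]; exact Finset.mem_insert_self _ _)
    have hgE : ∃ f ∈ E, g ∈ f := by
      rcases hf with rfl | hf
      · rcases Sym2.mem_iff.1 hgf with h1 | h1
        · exact absurd h1 hgb
        · exact absurd h1 hgc
      · exact ⟨f, hf, hgf⟩
    have h' := ih hgE (fun hm => hnew (Finset.mem_insert_of_mem hm))
    rw [Finset.insert_comm]
    refine GZSP.IsSPNet.hubRight h' ?_
    rw [Finset.mem_insert, not_or]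
    refine ⟨fun heq => hgb ?_, he⟩
    rcases Sym2.eq_iff.1 heq with ⟨h1, -⟩ | ⟨h1, h2⟩
    · exact h1.symm
    · exact absurd h2 hgc.symm
  | @series E₁ E₂ a m b h₁ h₂ hd hS ha hb ih₁ ih₂ =>
    obtain ⟨f, hf, hgf⟩ := hg
    rw [Finset.mem_union] at hf
    rw [Finset.mem_union, not_or] at hnew
    have hbc : b ≠ c := h₂.terminals_ne.2.2
    have hac : a ≠ c := h₁.terminals_ne.2.1
    rcases hf with hf | hf
    · -- `g` is a vertex of `E₁`
      have h' := GZSP.IsSPNet.series (ih₁ ⟨f, hf, hgf⟩ hnew.1) h₂ ?_ ?_ ha ?_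
      · rwa [Finset.insert_union] at h'
      · rw [Finset.disjoint_insert_left]; exact ⟨hnew.2, hd⟩
      · rintro z ⟨e, he, hze⟩ hz2
        rw [Finset.mem_insert] at he
        rcases he with rfl | he
        · rcases Sym2.mem_iff.1 hze with rfl | rfl
          · exact hS z ⟨f, hf, hgf⟩ hz2
          · exact Or.inr rfl
        · exact hS z ⟨e, he, hze⟩ hz2
      · intro e he hbe
        rw [Finset.mem_insert] at he
        rcases he with rfl | he
        · rcases Sym2.mem_iff.1 hbe with rfl | rfl
          · exact hb f hf hgf
          · exact hbc rfl
        · exact hb e he hbe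
    · -- `g` is a vertex of `E₂`
      have h' := GZSP.IsSPNet.series h₁ (ih₂ ⟨f, hf, hgf⟩ hnew.2) ?_ ?_ ?_ hb
      · rwa [Finset.union_insert] at h'
      · rw [Finset.disjoint_insert_right]; exact ⟨hnew.1, hd⟩
      · rintro z hz1 ⟨e, he, hze⟩
        rw [Finset.mem_insert] at he
        rcases he with rfl | he
        · rcases Sym2.mem_iff.1 hze with rfl | rfl
          · exact hS z hz1 ⟨f, hf, hgf⟩
          · exact Or.inr rfl
        · exact hS z hz1 ⟨e, he, hze⟩
      · intro e he hae
        rw [Finset.mem_insert] at he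
        rcases he with rfl | he
        · rcases Sym2.mem_iff.1 hae with rfl | rfl
          · exact ha f hf hgf
          · exact hac rfl
        · exact ha e he hae
  | @parallel E₁ E₂ a b h₁ h₂ hd hS ih₁ ih₂ =>
    obtain ⟨f, hf, hgf⟩ := hg
    rw [Finset.mem_union] at hf
    rw [Finset.mem_union, not_or] at hnew
    rcases hf with hf | hf
    · have h' := GZSP.IsSPNet.parallel (ih₁ ⟨f, hf, hgf⟩ hnew.1) h₂ ?_ ?_
      · rwa [Finset.insert_union] at h'
      · rw [Finset.disjoint_insert_left]; exact ⟨hnew.2, hd⟩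
      · rintro z ⟨e, he, hze⟩ hz2
        rw [Finset.mem_insert] at he
        rcases he with rfl | he
        · rcases Sym2.mem_iff.1 hze with rfl | rfl
          · exact hS z ⟨f, hf, hgf⟩ hz2
          · exact Or.inr (Or.inr rfl)
        · exact hS z ⟨e, he, hze⟩ hz2
    · have h' := GZSP.IsSPNet.parallel h₁ (ih₂ ⟨f, hf, hgf⟩ hnew.2) ?_ ?_
      · rwa [Finset.union_insert] at h'
      · rw [Finset.disjoint_insert_right]; exact ⟨hnew.1, hd⟩
      · rintro z hz1 ⟨e, he, hze⟩
        rw [Finset.mem_insert] at he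
        rcases he with rfl | he
        · rcases Sym2.mem_iff.1 hze with rfl | rfl
          · exact hS z hz1 ⟨f, hf, hgf⟩
          · exact Or.inr (Or.inr rfl)
        · exact hS z hz1 ⟨e, he, hze⟩

omit [Fintype V] in
/-- **Hubs anywhere.**  A two-terminal series–parallel hub network stays in the class when the hub `c` is joined to ANY finite set `A` of its
vertices (`A.image (s(·, c))` added; vertices of `A` off the network or already joined are not allowed, `c ∉ A`). [folklore] -/
theorem _root_.Summit.CriticalPhenomena.PercolationContinuityZ3.Theorems.GZSP.IsSPNet.union_hubs {c : V} {E : Finset (Sym2 V)} {a b : V}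
    (h : GZSP.IsSPNet c E a b) (A : Finset V) (hA : ∀ g ∈ A, (∃ f ∈ E, g ∈ f) ∧ g ≠ c ∧ s(g, c) ∉ E) :
    GZSP.IsSPNet c (E ∪ A.image (fun g => s(g, c))) a b := by
  induction A using Finset.induction_on with
  | empty => simpa using h
  | @insert g A hgA ih =>
    have hA' : ∀ g' ∈ A, (∃ f ∈ E, g' ∈ f) ∧ g' ≠ c ∧ s(g', c) ∉ E := fun g' hg' => hA g' (Finset.mem_insert_of_mem hg')
    obtain ⟨hgE, hgc, hgnew⟩ := hA g (Finset.mem_insert_self _ _)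
    have h' := ih hA'
    have hnot : s(g, c) ∉ E ∪ A.image (fun g => s(g, c)) := by
      rw [Finset.mem_union, Finset.mem_image, not_or]
      refine ⟨hgnew, ?_⟩
      rintro ⟨g', hg'A, heq⟩
      have hg'c := (hA' g' hg'A).2.1
      rcases Sym2.eq_iff.1 heq with ⟨h1, -⟩ | ⟨h1, -⟩
      · exact hgA (h1 ▸ hg'A)
      · exact hg'c h1
    have h'' := h'.insert_hub (hgE.imp fun f hf => ⟨Finset.mem_union_left _ hf.1, hf.2⟩) hgc hnot
    rw [Finset.image_insert, Finset.union_insert]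
    exact h''

/-- **THE SERIES–PARALLEL THEOREM, core form.**  If the CORE `R` (an edge set avoiding the apex `o`) is a two-terminal series–parallel network between
the ports `u, v` (`GZSP.IsSPNet o R u v`) and the apex `o` is joined to an arbitrary set `A` of vertices of `R`, then for all weights in `[0,1]`
`(P(u,v ∈ C_o) − P(u ∈ C_o)P(v ∈ C_o))² ≤ (28/27)·P(u ∈ C_o)·P(v ∈ C_o)·P(u ∉ C_o, v ∈ C_u)` on `R ∪ {s(g, o) : g ∈ A}`. [this work] -/
theorem sp_E_le_hubs (p : Sym2 V → ℝ) (hp0 : ∀ e, 0 ≤ p e) (hp1 : ∀ e, p e ≤ 1) {o : V} {R : Finset (Sym2 V)} {u v : V}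
    (h : GZSP.IsSPNet o R u v) (hRo : ∀ f ∈ R, o ∉ f) (A : Finset V) (hA : ∀ g ∈ A, ∃ f ∈ R, g ∈ f) :
    (PrW (R ∪ A.image (fun g => s(g, o))) p {K : Finset (Sym2 V) | u ∈ cl K o ∧ v ∈ cl K o}
        - PrW (R ∪ A.image (fun g => s(g, o))) p {K : Finset (Sym2 V) | u ∈ cl K o}
          * PrW (R ∪ A.image (fun g => s(g, o))) p {K : Finset (Sym2 V) | v ∈ cl K o}) ^ 2
      ≤ 28 / 27 * PrW (R ∪ A.image (fun g => s(g, o))) p {K : Finset (Sym2 V) | u ∈ cl K o}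
        * PrW (R ∪ A.image (fun g => s(g, o))) p {K : Finset (Sym2 V) | v ∈ cl K o}
        * PrW (R ∪ A.image (fun g => s(g, o))) p {K : Finset (Sym2 V) | u ∉ cl K o ∧ v ∈ cl K (u)} :=
  sp_E_le p hp0 hp1 (h.union_hubs A fun g hg => by
    obtain ⟨f, hf, hgf⟩ := hA g hg
    exact ⟨⟨f, hf, hgf⟩, fun hgo => hRo f hf (hgo ▸ hgf), fun hm => hRo _ hm (Sym2.mem_mk_right _ _)⟩)

/-- **THREE-POINT INEQUALITY IN SERIES–PARALLEL GRAPHS, core form.**  For a two-terminal series–parallel graph `R` with terminals `u, v`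
(`GZSP.IsSPNet o R u v` for a symbol `o` off `R`), any vertex `g` of `R` and all weights in `[0,1]`:
`P_R(g ↔ u, g ↔ v)² ≤ (28/27) · P_R(g ↔ u) · P_R(g ↔ v) · P_R(u ↔ v)`; sharp (`sp_E_le_sharp`). [this work] -/
theorem sp_threePoint_le' (p : Sym2 V → ℝ) (hp0 : ∀ e, 0 ≤ p e) (hp1 : ∀ e, p e ≤ 1) {o g u v : V} {R : Finset (Sym2 V)}
    (h : GZSP.IsSPNet o R u v) (hRo : ∀ f ∈ R, o ∉ f) (hg : ∃ f ∈ R, g ∈ f) :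
    (PrW R p {K : Finset (Sym2 V) | u ∈ cl K g ∧ v ∈ cl K g}) ^ 2
      ≤ 28 / 27 * PrW R p {K : Finset (Sym2 V) | u ∈ cl K g} * PrW R p {K : Finset (Sym2 V) | v ∈ cl K g}
        * PrW R p {K : Finset (Sym2 V) | v ∈ cl K u} := by
  obtain ⟨f, hf, hgf⟩ := hg
  have hgo : g ≠ o := fun hgo => hRo f hf (hgo ▸ hgf)
  have hnew : s(g, o) ∉ R := fun hm => hRo _ hm (Sym2.mem_mk_right _ _)
  have h' := h.insert_hub ⟨f, hf, hgf⟩ hgo hnew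
  rw [Sym2.eq_swap] at h'
  have hnew' : s(o, g) ∉ R := by rw [Sym2.eq_swap]; exact hnew
  have key := sp_threePoint_le p hp0 hp1 h' hgo.symm (Finset.mem_insert_self _ _) (fun f' hf' hof' => by
    rw [Finset.mem_insert] at hf'
    rcases hf' with rfl | hf'
    · rfl
    · exact absurd hof' (hRo f' hf'))
  rwa [Finset.erase_insert hnew'] at key

end APL

end Summit.CriticalPhenomena.PercolationContinuityZ3.Theorems
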